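import Literature.Geometry.Lorentzian.KerrSeparatedTrapping
import HarnessLib

/-!
# Uniform bounds on Carter's potential `V = V₀ + V₁` and its large-`r` monotonicity
# (Dafermos–Rodnianski–Shlapentokh-Rothman, §8.3 and §8.4, the estimates (someBoundS), (decrease))

(family `gr`, infrastructure for statement **gr.S24**; namespace `Literature.Geometry.Lorentzian.Kerr`)

The multiplier constructions of Dafermos–Rodnianski–Shlapentokh-Rothman (*Decay for solutions of
the wave equation on Kerr exterior spacetimes III*, arXiv:1402.7034 = Ann. of Math. 183 (2016),
§8) use, besides the fine structure of `V₀` of their §6 (`KerrSeparatedPotential.lean`,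
`KerrSeparatedTrapping.lean`), only crude bounds on the potential
`V = V₀ + V₁`, `V₀ = (4Mramω − a²m² + ΔΛ)/(r² + a²)²`,
`V₁ = Δ(3r² − 4Mr + a²)/(r² + a²)³ − 3Δ²r²/(r² + a²)⁴` of Carter's radial ODE (§5.2.3, §6.2),
uniform in the admissible frequency triple `(ω, m, Λ)` (Def. 6.1.1: `Λ ≥ |m|(|m| + 1)`,
`Λ ≥ 2|amω|`):

* §8.3 (proof of Lemma 8.3.1): "`|V₁| ≤ Br⁻³`, `|dV₁/dr| ≤ Br⁻⁴`" and "`|dV₀/dr| ≤ BΛ`";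
* §8.4 (proof of Prop. 8.4.1), (someBoundS): `|V| ≤ B(ε⁻¹Λ + εω² + ω_high⁻²ω²)`,
  `|V'| ≤ BΔr⁻⁵(ε⁻¹Λ + εω² + ω_high⁻²ω²)` (`' = d/dr* = (Δ/(r² + a²)) d/dr`), and (decrease): "the
  admissibility inequalities `Λ ≥ 2a|mω|` and `Λ ≥ |m|(|m| + 1)` imply that there exists a constant
  `R_dec` only depending on `a₀` and `M` such that `V' < 0` for `r* ≥ R*_dec`".

This file **proves** these with explicit constants, for `0 < M`, `|a| ≤ M` (resp. `|a| < M`) and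
`r ≥ r₊` (all that is used is `r ≥ M ≥ |a|`):

* `abs_sepPotential₀_le`: `|V₀| ≤ 3Λ/r²`; `sepPotential₁_le`: `0 ≤ V₁ ≤ 3M/r³`;
  `abs_sepPotential_le`: `|V| ≤ 3Λ/r² + 3M/r³` (using admissibility instead of the auxiliary `ε`
  of (someBoundS): `4Mr|amω| ≤ 2MrΛ`);
* `abs_critPoly_le`: `|(r² + a²)³ dV₀/dr| ≤ 24Λr³`, whence `abs_deriv_sepPotential₀_le`:
  `|dV₀/dr| ≤ 24Λ/r³`;
* `critPoly₁`, `hasDerivAt_sepPotential₁`: `dV₁/dr = P₁(r)/(r² + a²)⁵` with the explicit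
  sextic `P₁ = −6Mr⁶ + (16M² − 4a²)r⁵ + 30Ma²r⁴ − (64M²a² + 8a⁴)r³ + 30Ma⁴r² + (16M²a⁴ − 4a⁶)r − 6Ma⁶`;
  `abs_critPoly₁_le`: `|P₁| ≤ 184Mr⁶`, whence `abs_deriv_sepPotential₁_le`: `|dV₁/dr| ≤ 184M/r⁴`;
  `critPoly₁_neg_of_five_mul_le`: `P₁ < 0` for `r ≥ 5M`;
* `hasDerivAt_sepPotential`, `abs_deriv_sepPotential_le`: `|dV/dr| ≤ 24Λ/r³ + 184M/r⁴`;
* `deriv_sepPotential_neg_of_seven_mul_le` — **(decrease) with `R_dec = 7M`**: for `|a| < M` and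
  every admissible triple, `dV/dr < 0` for all `r ≥ 7M` (from `dV₀/dr < 0` there when `Λ > 0`,
  `KerrSeparatedTrapping.deriv_sepPotential₀_neg_of_seven_mul_le`, `V₀ ≡ 0` when `Λ = 0`, and
  `dV₁/dr < 0` for `r ≥ 5M`).

## References

* M. Dafermos, I. Rodnianski, Y. Shlapentokh-Rothman, arXiv:1402.7034 = Ann. of Math. 183
  (2016), §6.2 (the decomposition `V = V₀ + V₁`), §8.3 (proof of Lemma 8.3.1: the bounds on `V₁`,
  `dV₁/dr`, `dV₀/dr`), §8.4 (proof of Prop. 8.4.1: (someBoundS), (decrease))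
  (key `DafermosRodnianskiShlapentokhrothman2014`).
-/

noncomputable section

namespace Literature.Geometry.Lorentzian

namespace Kerr

open Set

/-! ### Elementary facts on `r ≥ r₊` -/

/-- `M ≤ r₊` (`r₊ = M + √(M² − a²)`). [folklore] -/
theorem M_le_rPlus (M a : ℝ) : M ≤ rPlus M a := by
  unfold rPlus; linarith [Real.sqrt_nonneg (M ^ 2 - a ^ 2)]

/-- `|Δ| ≤ r² + a²` for `0 ≤ M ≤ r` (`Δ = r² + a² − 2Mr` and `2Mr ≤ 2r² ≤ 2(r² + a²)`).
[folklore] -/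
theorem abs_delta_le {M a r : ℝ} (hM : 0 ≤ M) (hr : M ≤ r) : |delta M a r| ≤ r ^ 2 + a ^ 2 := by
  have hr0 : 0 ≤ r := hM.trans hr
  rw [abs_le]
  unfold delta
  constructor <;> nlinarith [sq_nonneg a]

/-! ### `|V₀| ≤ 3Λ/r²` -/

/-- **`|V₀| ≤ 3Λ/r²`** for `0 < M ≤ r`, `|a| ≤ M` and an admissible triple: the numerator obeys
`|4Mramω − a²m² + ΔΛ| ≤ 2MrΛ + a²Λ + (r² + a²)Λ ≤ 3Λ(r² + a²)` by `2|amω| ≤ Λ`, `m² ≤ Λ`. This is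
the `V₀`-part of (someBoundS) of DRSR arXiv:1402.7034, §8.4 (there with an auxiliary `ε`, here
via admissibility). [cite: DafermosRodnianskiShlapentokhrothman2014, §8.4] -/
theorem abs_sepPotential₀_le {M a ω Λ r : ℝ} {m : ℤ} (hM : 0 < M) (haM : |a| ≤ M)
    (hadm : IsAdmissibleTriple a ω m Λ) (hr : M ≤ r) :
    |sepPotential₀ M a ω m Λ r| ≤ 3 * Λ / r ^ 2 := by
  have hr0 : 0 < r := hM.trans_le hr
  have hΛ : 0 ≤ Λ := hadm.nonneg
  have ha2 : a ^ 2 ≤ M ^ 2 := by nlinarith [sq_abs a, abs_nonneg a]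
  have hD : 0 < r ^ 2 + a ^ 2 := by positivity
  have h1 : |4 * M * r * a * m * ω| ≤ 2 * M * r * Λ := by
    have : 4 * M * r * a * m * ω = (4 * M * r) * (a * m * ω) := by ring
    rw [this, abs_mul, abs_of_pos (by positivity : (0 : ℝ) < 4 * M * r)]
    nlinarith [hadm.2, mul_pos hM hr0]
  have h2 : |a ^ 2 * (m : ℝ) ^ 2| ≤ a ^ 2 * Λ := by
    rw [abs_of_nonneg (by positivity)]
    exact mul_le_mul_of_nonneg_left hadm.sq_le (sq_nonneg a)
  have h3 : |delta M a r * Λ| ≤ (r ^ 2 + a ^ 2) * Λ := by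
    rw [abs_mul, abs_of_nonneg hΛ]
    exact mul_le_mul_of_nonneg_right (abs_delta_le hM.le hr) hΛ
  have hN : |4 * M * r * a * m * ω - a ^ 2 * (m : ℝ) ^ 2 + delta M a r * Λ| ≤
      3 * Λ * (r ^ 2 + a ^ 2) := by
    have hMr : 2 * M * r * Λ ≤ 2 * r ^ 2 * Λ := by
      have : M * r ≤ r * r := mul_le_mul_of_nonneg_right hr hr0.le
      nlinarith
    calc |4 * M * r * a * m * ω - a ^ 2 * (m : ℝ) ^ 2 + delta M a r * Λ|
        ≤ |4 * M * r * a * m * ω - a ^ 2 * (m : ℝ) ^ 2| + |delta M a r * Λ| := abs_add_le _ _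
      _ ≤ |4 * M * r * a * m * ω| + |a ^ 2 * (m : ℝ) ^ 2| + |delta M a r * Λ| := by
          gcongr; exact abs_sub _ _
      _ ≤ 2 * M * r * Λ + a ^ 2 * Λ + (r ^ 2 + a ^ 2) * Λ := by gcongr
      _ ≤ 3 * Λ * (r ^ 2 + a ^ 2) := by nlinarith [sq_nonneg a]
  unfold sepPotential₀
  rw [abs_div, abs_of_pos (pow_pos hD 2)]
  calc |4 * M * r * a * m * ω - a ^ 2 * (m : ℝ) ^ 2 + delta M a r * Λ| / (r ^ 2 + a ^ 2) ^ 2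
      ≤ 3 * Λ * (r ^ 2 + a ^ 2) / (r ^ 2 + a ^ 2) ^ 2 := by gcongr
    _ = 3 * Λ / (r ^ 2 + a ^ 2) := by field_simp
    _ ≤ 3 * Λ / r ^ 2 := by
        apply div_le_div_of_nonneg_left (by positivity) (by positivity)
        nlinarith [sq_nonneg a]

/-! ### `0 ≤ V₁ ≤ 3M/r³` -/

/-- **`V₁ ≤ 3M/r³`** on `r ≥ r₊` (`|a| ≤ M`, `0 < M`): from `V₁ = Δ(a²Δ + 2Mr(r² − a²))/(r² + a²)⁴`
with `0 ≤ Δ ≤ r² + a²` and `a²Δ + 2Mr(r² − a²) ≤ (M² + 2Mr)(r² + a²) ≤ 3Mr(r² + a²)`. The bound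
"`|V₁| ≤ Br⁻³`" of DRSR arXiv:1402.7034, §8.3 (proof of Lemma 8.3.1), with `B = 3M`.
[cite: DafermosRodnianskiShlapentokhrothman2014, Lemma 8.3.1 (proof)] -/
theorem sepPotential₁_le {M a r : ℝ} (hM : 0 < M) (haM : |a| ≤ M) (hr : rPlus M a ≤ r) :
    sepPotential₁ M a r ≤ 3 * M / r ^ 3 := by
  have hMr : M ≤ r := (M_le_rPlus M a).trans hr
  have hr0 : 0 < r := hM.trans_le hMr
  have ha2 : a ^ 2 ≤ M ^ 2 := by nlinarith [sq_abs a, abs_nonneg a]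
  have hD : 0 < r ^ 2 + a ^ 2 := by positivity
  have hΔ0 : 0 ≤ delta M a r := delta_nonneg haM hr
  have hΔD : delta M a r ≤ r ^ 2 + a ^ 2 := by unfold delta; nlinarith
  rw [sepPotential₁_eq M a hD.ne']
  have hnum : a ^ 2 * delta M a r + 2 * M * r * (r ^ 2 - a ^ 2) ≤ 3 * M * r * (r ^ 2 + a ^ 2) := by
    have h1 : a ^ 2 * delta M a r ≤ M ^ 2 * (r ^ 2 + a ^ 2) :=
      mul_le_mul ha2 hΔD hΔ0 (sq_nonneg M)
    have h2 : M ^ 2 * (r ^ 2 + a ^ 2) ≤ M * r * (r ^ 2 + a ^ 2) := by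
      apply mul_le_mul_of_nonneg_right _ hD.le
      nlinarith
    nlinarith [mul_nonneg (mul_nonneg hM.le hr0.le) (sq_nonneg a)]
  calc delta M a r / (r ^ 2 + a ^ 2) ^ 4 * (a ^ 2 * delta M a r + 2 * M * r * (r ^ 2 - a ^ 2))
      ≤ (r ^ 2 + a ^ 2) / (r ^ 2 + a ^ 2) ^ 4 * (3 * M * r * (r ^ 2 + a ^ 2)) := by
        apply mul_le_mul (div_le_div_of_nonneg_right hΔD (by positivity)) hnum
        · -- `0 ≤ a²Δ + 2Mr(r² − a²)` on `r ≥ r₊` (`Δ ≥ 0`, `r² ≥ a²`)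
          have har : a ^ 2 ≤ r ^ 2 := by nlinarith
          nlinarith [mul_nonneg (sq_nonneg a) hΔ0,
            mul_nonneg (mul_nonneg hM.le hr0.le) (sub_nonneg.2 har)]
        · positivity
    _ = 3 * M * r / (r ^ 2 + a ^ 2) ^ 2 := by field_simp
    _ ≤ 3 * M * r / (r ^ 2) ^ 2 := by
        apply div_le_div_of_nonneg_left (by positivity) (by positivity)
        gcongr; nlinarith [sq_nonneg a]
    _ = 3 * M / r ^ 3 := by field_simp

/-- **`|V| ≤ 3Λ/r² + 3M/r³`** on `r ≥ r₊` for `0 < M`, `|a| ≤ M` and an admissible triple — the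
bound (someBoundS) on `V` of DRSR arXiv:1402.7034, §8.4 in explicit form (in `𝓖_♯`, where
`Λ ≤ ε_width ω²` and `ω² ≥ ω_high²`, it gives on `r ≥ r₊ ≥ M` the smallness
`|V| ≤ 3(ε_width + ω_high⁻²) ω²/M²` used there). [cite: DafermosRodnianskiShlapentokhrothman2014, §8.4] -/
theorem abs_sepPotential_le {M a ω Λ r : ℝ} {m : ℤ} (hM : 0 < M) (haM : |a| ≤ M)
    (hadm : IsAdmissibleTriple a ω m Λ) (hr : rPlus M a ≤ r) :
    |sepPotential M a ω m Λ r| ≤ 3 * Λ / r ^ 2 + 3 * M / r ^ 3 := by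
  have hMr : M ≤ r := (M_le_rPlus M a).trans hr
  have h0 := abs_sepPotential₀_le hM haM hadm hMr
  have h1 := sepPotential₁_le hM haM hr
  have h1' : 0 ≤ sepPotential₁ M a r := sepPotential₁_nonneg haM hr
  unfold sepPotential
  calc |sepPotential₀ M a ω m Λ r + sepPotential₁ M a r|
      ≤ |sepPotential₀ M a ω m Λ r| + |sepPotential₁ M a r| := abs_add_le _ _
    _ ≤ 3 * Λ / r ^ 2 + 3 * M / r ^ 3 := by rw [abs_of_nonneg h1']; gcongr

/-! ### `|dV₀/dr| ≤ 24Λ/r³` -/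

/-- **`|(r² + a²)³ dV₀/dr| ≤ 24Λr³`** for `0 < M ≤ r`, `|a| ≤ M` and an admissible triple:
`|4maMω(−3r² + a²)| ≤ 2MΛ(3r² + a²) ≤ 8Λr³`, `|4ra²m²| ≤ 4Λr³`,
`|2Λ(r³ + a²r − 3Mr² + Ma²)| ≤ 12Λr³`. Quantifies "`|dV₀/dr| ≤ BΛ`" of DRSR arXiv:1402.7034,
§8.3 (proof of Lemma 8.3.1). [cite: DafermosRodnianskiShlapentokhrothman2014, Lemma 8.3.1 (proof)] -/
theorem abs_critPoly_le {M a ω Λ r : ℝ} {m : ℤ} (hM : 0 < M) (haM : |a| ≤ M)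
    (hadm : IsAdmissibleTriple a ω m Λ) (hr : M ≤ r) :
    |critPoly M a ω m Λ r| ≤ 24 * Λ * r ^ 3 := by
  have hr0 : 0 < r := hM.trans_le hr
  have hΛ : 0 ≤ Λ := hadm.nonneg
  have ha2 : a ^ 2 ≤ r ^ 2 := by nlinarith [sq_abs a, abs_nonneg a]
  have hT1 : |4 * m * a * M * ω * (-3 * r ^ 2 + a ^ 2)| ≤ 8 * Λ * r ^ 3 := by
    have : 4 * m * a * M * ω * (-3 * r ^ 2 + a ^ 2) = (4 * M) * (a * m * ω) * (-3 * r ^ 2 + a ^ 2) := by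
      ring
    rw [this, abs_mul, abs_mul, abs_of_pos (by positivity : (0 : ℝ) < 4 * M)]
    have hb : |-3 * r ^ 2 + a ^ 2| ≤ 4 * r ^ 2 := by
      rw [abs_le]; constructor <;> nlinarith
    calc 4 * M * |a * ↑m * ω| * |-3 * r ^ 2 + a ^ 2| ≤ 4 * M * (Λ / 2) * (4 * r ^ 2) := by
          gcongr; linarith [hadm.2]
      _ = 8 * Λ * (M * r ^ 2) := by ring
      _ ≤ 8 * Λ * (r * r ^ 2) := by gcongr
      _ = 8 * Λ * r ^ 3 := by ring
  have hT2 : |4 * r * a ^ 2 * (m : ℝ) ^ 2| ≤ 4 * Λ * r ^ 3 := by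
    rw [abs_of_nonneg (by positivity)]
    calc 4 * r * a ^ 2 * (m : ℝ) ^ 2 ≤ 4 * r * r ^ 2 * Λ := by gcongr; exact hadm.sq_le
      _ = 4 * Λ * r ^ 3 := by ring
  have hT3 : |2 * Λ * (r ^ 3 + a ^ 2 * r - 3 * M * r ^ 2 + M * a ^ 2)| ≤ 12 * Λ * r ^ 3 := by
    rw [abs_mul, abs_of_nonneg (by positivity : (0 : ℝ) ≤ 2 * Λ)]
    have hb : |r ^ 3 + a ^ 2 * r - 3 * M * r ^ 2 + M * a ^ 2| ≤ 6 * r ^ 3 := by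
      rw [abs_le]
      have h1 : a ^ 2 * r ≤ r ^ 2 * r := mul_le_mul_of_nonneg_right ha2 hr0.le
      have h2 : M * r ^ 2 ≤ r * r ^ 2 := mul_le_mul_of_nonneg_right hr (sq_nonneg r)
      have h3 : M * a ^ 2 ≤ r * r ^ 2 := mul_le_mul hr ha2 (sq_nonneg a) hr0.le
      have h4 : 0 ≤ M * r ^ 2 := by positivity
      have h5 : 0 ≤ M * a ^ 2 := by positivity
      have h6 : 0 ≤ a ^ 2 * r := by positivity
      constructor <;> nlinarith
    calc 2 * Λ * |r ^ 3 + a ^ 2 * r - 3 * M * r ^ 2 + M * a ^ 2| ≤ 2 * Λ * (6 * r ^ 3) := by gcongr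
      _ = 12 * Λ * r ^ 3 := by ring
  unfold critPoly
  calc |4 * m * a * M * ω * (-3 * r ^ 2 + a ^ 2) + 4 * r * a ^ 2 * (m : ℝ) ^ 2 -
        2 * Λ * (r ^ 3 + a ^ 2 * r - 3 * M * r ^ 2 + M * a ^ 2)|
      ≤ |4 * m * a * M * ω * (-3 * r ^ 2 + a ^ 2) + 4 * r * a ^ 2 * (m : ℝ) ^ 2| +
          |2 * Λ * (r ^ 3 + a ^ 2 * r - 3 * M * r ^ 2 + M * a ^ 2)| := abs_sub _ _
    _ ≤ |4 * m * a * M * ω * (-3 * r ^ 2 + a ^ 2)| + |4 * r * a ^ 2 * (m : ℝ) ^ 2| +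
          |2 * Λ * (r ^ 3 + a ^ 2 * r - 3 * M * r ^ 2 + M * a ^ 2)| := by
        gcongr; exact abs_add_le _ _
    _ ≤ 8 * Λ * r ^ 3 + 4 * Λ * r ^ 3 + 12 * Λ * r ^ 3 := by gcongr
    _ = 24 * Λ * r ^ 3 := by ring

/-- **`|dV₀/dr| ≤ 24Λ/r³`** for `0 < M ≤ r`, `|a| ≤ M` and an admissible triple. DRSR
arXiv:1402.7034, §8.3–§8.4 ("`|dV₀/dr| ≤ BΛ`", (someBoundS)). [cite: DafermosRodnianskiShlapentokhrothman2014, §8.4] -/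
theorem abs_deriv_sepPotential₀_le {M a ω Λ r : ℝ} {m : ℤ} (hM : 0 < M) (haM : |a| ≤ M)
    (hadm : IsAdmissibleTriple a ω m Λ) (hr : M ≤ r) :
    |deriv (sepPotential₀ M a ω m Λ) r| ≤ 24 * Λ / r ^ 3 := by
  have hr0 : 0 < r := hM.trans_le hr
  have hD : 0 < r ^ 2 + a ^ 2 := by positivity
  rw [deriv_sepPotential₀_eq M a ω m Λ hD.ne', abs_div, abs_of_pos (pow_pos hD 3)]
  calc |critPoly M a ω m Λ r| / (r ^ 2 + a ^ 2) ^ 3 ≤ 24 * Λ * r ^ 3 / (r ^ 2 + a ^ 2) ^ 3 := by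
        gcongr; exact abs_critPoly_le hM haM hadm hr
    _ ≤ 24 * Λ * r ^ 3 / (r ^ 2) ^ 3 := by
        apply div_le_div_of_nonneg_left (by positivity [hadm.nonneg]) (by positivity)
        gcongr; nlinarith [sq_nonneg a]
    _ = 24 * Λ / r ^ 3 := by field_simp

/-! ### The derivative of `V₁` -/

/-- The **sextic `P₁ = (r² + a²)⁵ dV₁/dr`**
`= −6Mr⁶ + (16M² − 4a²)r⁵ + 30Ma²r⁴ − (64M²a² + 8a⁴)r³ + 30Ma⁴r² + (16M²a⁴ − 4a⁶)r − 6Ma⁶`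
(differentiating `V₁ = Δ(3r² − 4Mr + a²)/(r² + a²)³ − 3Δ²r²/(r² + a²)⁴`; leading behaviour
`dV₁/dr ≈ −6M/r⁴`, matching `V₁ ≈ 2M/r³`). Not displayed in DRSR arXiv:1402.7034, where only the
consequences `|dV₁/dr| ≤ Br⁻⁴` (§8.3) and (decrease) (§8.4) are recorded. [folklore] -/
def critPoly₁ (M a r : ℝ) : ℝ :=
  -6 * M * r ^ 6 + (16 * M ^ 2 - 4 * a ^ 2) * r ^ 5 + 30 * M * a ^ 2 * r ^ 4 -
    (64 * M ^ 2 * a ^ 2 + 8 * a ^ 4) * r ^ 3 + 30 * M * a ^ 4 * r ^ 2 +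
    (16 * M ^ 2 * a ^ 4 - 4 * a ^ 6) * r - 6 * M * a ^ 6

/-- **`dV₁/dr = P₁/(r² + a²)⁵`** wherever `r² + a² ≠ 0`. [folklore] -/
theorem hasDerivAt_sepPotential₁ (M a : ℝ) {r : ℝ} (hr : r ^ 2 + a ^ 2 ≠ 0) :
    HasDerivAt (sepPotential₁ M a) (critPoly₁ M a r / (r ^ 2 + a ^ 2) ^ 5) r := by
  -- first fraction `Δ(3r² − 4Mr + a²)/(r² + a²)³`
  have hq : HasDerivAt (fun s : ℝ ↦ 3 * s ^ 2 - 4 * M * s + a ^ 2) (3 * (2 * r) - 4 * M) r := by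
    have h := (((hasDerivAt_id r).pow 2).const_mul 3).sub ((hasDerivAt_id r).const_mul (4 * M))
    have h' : HasDerivAt (fun s : ℝ ↦ 3 * s ^ 2 - 4 * M * s) (3 * (↑(2 : ℕ) * r ^ (2 - 1) * 1) -
        4 * M * 1) r := h
    have h'' := h'.add_const (a ^ 2)
    refine h''.congr_deriv ?_
    push_cast; ring
  have hN₁ := (hasDerivAt_delta M a r).mul hq
  have hF₁ := hN₁.div (hasDerivAt_sq_add_sq_pow a 3 r) (pow_ne_zero 3 hr)
  -- second fraction `3Δ²r²/(r² + a²)⁴`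
  have hN₂ : HasDerivAt (fun s : ℝ ↦ 3 * delta M a s ^ 2 * s ^ 2)
      (3 * (↑(2 : ℕ) * delta M a r ^ (2 - 1) * (2 * (r - M))) * r ^ 2 +
        3 * delta M a r ^ 2 * (↑(2 : ℕ) * r ^ (2 - 1) * 1)) r :=
    (((hasDerivAt_delta M a r).pow 2).const_mul 3).mul ((hasDerivAt_id r).pow 2)
  have hF₂ := hN₂.div (hasDerivAt_sq_add_sq_pow a 4 r) (pow_ne_zero 4 hr)
  have h := hF₁.sub hF₂
  have h' : HasDerivAt (sepPotential₁ M a)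
      (((2 * (r - M) * (3 * r ^ 2 - 4 * M * r + a ^ 2) + delta M a r * (3 * (2 * r) - 4 * M)) *
            (r ^ 2 + a ^ 2) ^ 3 -
          delta M a r * (3 * r ^ 2 - 4 * M * r + a ^ 2) *
            (↑(3 : ℕ) * (r ^ 2 + a ^ 2) ^ (3 - 1) * (2 * r))) /
          ((r ^ 2 + a ^ 2) ^ 3) ^ 2 -
        ((3 * (↑(2 : ℕ) * delta M a r ^ (2 - 1) * (2 * (r - M))) * r ^ 2 +
              3 * delta M a r ^ 2 * (↑(2 : ℕ) * r ^ (2 - 1) * 1)) *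
            (r ^ 2 + a ^ 2) ^ 4 -
          3 * delta M a r ^ 2 * r ^ 2 * (↑(4 : ℕ) * (r ^ 2 + a ^ 2) ^ (4 - 1) * (2 * r))) /
          ((r ^ 2 + a ^ 2) ^ 4) ^ 2) r := h
  refine h'.congr_deriv ?_
  unfold critPoly₁ delta
  push_cast
  field_simp
  ring

/-- `deriv V₁ = P₁/(r² + a²)⁵` wherever `r² + a² ≠ 0`. [folklore] -/
theorem deriv_sepPotential₁_eq (M a : ℝ) {r : ℝ} (hr : r ^ 2 + a ^ 2 ≠ 0) :
    deriv (sepPotential₁ M a) r = critPoly₁ M a r / (r ^ 2 + a ^ 2) ^ 5 :=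
  (hasDerivAt_sepPotential₁ M a hr).deriv

/-- **`|P₁| ≤ 184Mr⁶`** for `0 < M ≤ r`, `|a| ≤ M` (each coefficient bounded using
`a² ≤ M² ≤ Mr ≤ r²`). [folklore] -/
theorem abs_critPoly₁_le {M a r : ℝ} (hM : 0 < M) (haM : |a| ≤ M) (hr : M ≤ r) :
    |critPoly₁ M a r| ≤ 184 * M * r ^ 6 := by
  have hr0 : 0 < r := hM.trans_le hr
  have ha2 : a ^ 2 ≤ M ^ 2 := by nlinarith [sq_abs a, abs_nonneg a]
  have ha4 : a ^ 4 ≤ M ^ 4 := by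
    calc a ^ 4 = (a ^ 2) ^ 2 := by ring
      _ ≤ (M ^ 2) ^ 2 := pow_le_pow_left₀ (sq_nonneg a) ha2 2
      _ = M ^ 4 := by ring
  have ha6 : a ^ 6 ≤ M ^ 6 := by
    calc a ^ 6 = (a ^ 2) ^ 3 := by ring
      _ ≤ (M ^ 2) ^ 3 := pow_le_pow_left₀ (sq_nonneg a) ha2 3
      _ = M ^ 6 := by ring
  have hM2 : M ^ 2 ≤ r ^ 2 := pow_le_pow_left₀ hM.le hr 2
  have hM3 : M ^ 3 ≤ r ^ 3 := pow_le_pow_left₀ hM.le hr 3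
  have hM4 : M ^ 4 ≤ r ^ 4 := pow_le_pow_left₀ hM.le hr 4
  have hM5 : M ^ 5 ≤ r ^ 5 := pow_le_pow_left₀ hM.le hr 5
  have hM6 : M ^ 6 ≤ r ^ 6 := pow_le_pow_left₀ hM.le hr 6
  -- monomial bounds, all against `M r⁶`
  have e1 : M * r ^ 5 * M ≤ M * r ^ 5 * r := mul_le_mul_of_nonneg_left hr (by positivity)
  have e2 : a ^ 2 * r ^ 5 ≤ M ^ 2 * r ^ 5 := mul_le_mul_of_nonneg_right ha2 (by positivity)
  have e3 : M * r ^ 4 * a ^ 2 ≤ M * r ^ 4 * r ^ 2 :=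
    mul_le_mul_of_nonneg_left (ha2.trans hM2) (by positivity)
  have e4 : M ^ 2 * r ^ 3 * a ^ 2 ≤ M ^ 2 * r ^ 3 * M ^ 2 :=
    mul_le_mul_of_nonneg_left ha2 (by positivity)
  have e4' : M * r ^ 3 * M ^ 3 ≤ M * r ^ 3 * r ^ 3 := mul_le_mul_of_nonneg_left hM3 (by positivity)
  have e5 : a ^ 4 * r ^ 3 ≤ M ^ 4 * r ^ 3 := mul_le_mul_of_nonneg_right ha4 (by positivity)
  have e6 : M * r ^ 2 * a ^ 4 ≤ M * r ^ 2 * r ^ 4 :=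
    mul_le_mul_of_nonneg_left (ha4.trans hM4) (by positivity)
  have e7 : M ^ 2 * r * a ^ 4 ≤ M ^ 2 * r * M ^ 4 := mul_le_mul_of_nonneg_left ha4 (by positivity)
  have e7' : M * r * M ^ 5 ≤ M * r * r ^ 5 := mul_le_mul_of_nonneg_left hM5 (by positivity)
  have e8 : a ^ 6 * r ≤ M ^ 6 * r := mul_le_mul_of_nonneg_right ha6 hr0.le
  have e9 : M * a ^ 6 ≤ M * r ^ 6 := mul_le_mul_of_nonneg_left (ha6.trans hM6) hM.le
  have p1 : 0 ≤ M ^ 2 * r ^ 5 := by positivity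
  have p2 : 0 ≤ a ^ 2 * r ^ 5 := by positivity
  have p3 : 0 ≤ M * a ^ 2 * r ^ 4 := by positivity
  have p4 : 0 ≤ M ^ 2 * a ^ 2 * r ^ 3 := by positivity
  have p5 : 0 ≤ a ^ 4 * r ^ 3 := by positivity
  have p6 : 0 ≤ M * a ^ 4 * r ^ 2 := by positivity
  have p7 : 0 ≤ M ^ 2 * a ^ 4 * r := by positivity
  have p8 : 0 ≤ a ^ 6 * r := by positivity
  have p9 : 0 ≤ M * a ^ 6 := by positivity
  have p0 : 0 ≤ M * r ^ 6 := by positivity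
  rw [abs_le]
  unfold critPoly₁
  constructor <;> linarith

/-- **`|dV₁/dr| ≤ 184M/r⁴`** for `0 < M ≤ r`, `|a| ≤ M`: the bound "`|dV₁/dr| ≤ Br⁻⁴`" of DRSR
arXiv:1402.7034, §8.3 (proof of Lemma 8.3.1), with `B = 184M`.
[cite: DafermosRodnianskiShlapentokhrothman2014, Lemma 8.3.1 (proof)] -/
theorem abs_deriv_sepPotential₁_le {M a r : ℝ} (hM : 0 < M) (haM : |a| ≤ M) (hr : M ≤ r) :
    |deriv (sepPotential₁ M a) r| ≤ 184 * M / r ^ 4 := by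
  have hr0 : 0 < r := hM.trans_le hr
  have hD : 0 < r ^ 2 + a ^ 2 := by positivity
  rw [deriv_sepPotential₁_eq M a hD.ne', abs_div, abs_of_pos (pow_pos hD 5)]
  calc |critPoly₁ M a r| / (r ^ 2 + a ^ 2) ^ 5 ≤ 184 * M * r ^ 6 / (r ^ 2 + a ^ 2) ^ 5 := by
        gcongr; exact abs_critPoly₁_le hM haM hr
    _ ≤ 184 * M * r ^ 6 / (r ^ 2) ^ 5 := by
        apply div_le_div_of_nonneg_left (by positivity) (by positivity)
        gcongr; nlinarith [sq_nonneg a]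
    _ = 184 * M / r ^ 4 := by field_simp

/-- **`P₁ < 0` for `r ≥ 5M`** (`0 < M`, `|a| ≤ M`): dropping the negative terms and bounding
`a² ≤ M²`, `P₁ ≤ Mr(−6r⁵ + 16Mr⁴ + 30M²r³ + 30M⁴r + 16M⁵)`, and the quintic bracket equals
`−(4834M⁵ + 8470M⁴s + 4650M³s² + 1150M²s³ + 134Ms⁴ + 6s⁵)` at `r = 5M + s`. Hence
`dV₁/dr < 0` for `r ≥ 5M`. [folklore] -/
theorem critPoly₁_neg_of_five_mul_le {M a r : ℝ} (hM : 0 < M) (haM : |a| ≤ M) (hr : 5 * M ≤ r) :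
    critPoly₁ M a r < 0 := by
  have hr0 : 0 < r := by linarith
  have ha2 : a ^ 2 ≤ M ^ 2 := by nlinarith [sq_abs a, abs_nonneg a]
  have ha2' : 0 ≤ a ^ 2 := sq_nonneg a
  have ha4 : a ^ 4 ≤ M ^ 4 := by nlinarith
  have ha4' : 0 ≤ a ^ 4 := by positivity
  set s := r - 5 * M with hs
  have hs0 : 0 ≤ s := by linarith
  have hB : -6 * r ^ 5 + 16 * M * r ^ 4 + 30 * M ^ 2 * r ^ 3 + 30 * M ^ 4 * r + 16 * M ^ 5 =
      -(4834 * M ^ 5 + 8470 * M ^ 4 * s + 4650 * M ^ 3 * s ^ 2 + 1150 * M ^ 2 * s ^ 3 +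
        134 * M * s ^ 4 + 6 * s ^ 5) := by
    have : r = s + 5 * M := by rw [hs]; ring
    rw [this]; ring
  have hBneg : -6 * r ^ 5 + 16 * M * r ^ 4 + 30 * M ^ 2 * r ^ 3 + 30 * M ^ 4 * r + 16 * M ^ 5 < 0 := by
    rw [hB]
    have : 0 < 4834 * M ^ 5 := by positivity
    have : 0 ≤ 8470 * M ^ 4 * s + 4650 * M ^ 3 * s ^ 2 + 1150 * M ^ 2 * s ^ 3 +
        134 * M * s ^ 4 + 6 * s ^ 5 := by positivity
    linarith
  -- `P₁ ≤ M r · bracket`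
  have hr2 : 0 ≤ r ^ 2 := sq_nonneg r
  have hr3 : 0 ≤ r ^ 3 := by positivity
  have hr4 : 0 ≤ r ^ 4 := by positivity
  have hr5 : 0 ≤ r ^ 5 := by positivity
  have t2 : (16 * M ^ 2 - 4 * a ^ 2) * r ^ 5 ≤ 16 * M ^ 2 * r ^ 5 := by nlinarith
  have t3 : 30 * M * a ^ 2 * r ^ 4 ≤ 30 * M * M ^ 2 * r ^ 4 := by
    nlinarith [mul_le_mul_of_nonneg_right ha2 hr4]
  have t4 : -(64 * M ^ 2 * a ^ 2 + 8 * a ^ 4) * r ^ 3 ≤ 0 := by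
    have : 0 ≤ (64 * M ^ 2 * a ^ 2 + 8 * a ^ 4) * r ^ 3 := by positivity
    linarith
  have t5 : 30 * M * a ^ 4 * r ^ 2 ≤ 30 * M * M ^ 4 * r ^ 2 := by
    nlinarith [mul_le_mul_of_nonneg_right ha4 hr2]
  have t6 : (16 * M ^ 2 * a ^ 4 - 4 * a ^ 6) * r ≤ 16 * M ^ 2 * M ^ 4 * r := by
    have h1 : 16 * M ^ 2 * a ^ 4 - 4 * a ^ 6 ≤ 16 * M ^ 2 * M ^ 4 := by
      have : 0 ≤ a ^ 6 := by positivity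
      nlinarith
    exact mul_le_mul_of_nonneg_right h1 hr0.le
  have t7 : -6 * M * a ^ 6 ≤ 0 := by
    have : 0 ≤ a ^ 6 := by positivity
    nlinarith
  have hle : critPoly₁ M a r ≤
      M * r * (-6 * r ^ 5 + 16 * M * r ^ 4 + 30 * M ^ 2 * r ^ 3 + 30 * M ^ 4 * r + 16 * M ^ 5) := by
    unfold critPoly₁
    nlinarith
  have hMr : 0 < M * r := mul_pos hM hr0
  nlinarith [mul_neg_of_pos_of_neg hMr hBneg]

/-! ### The derivative of `V` and (decrease) -/

/-- `dV/dr = (r² + a²)⁻³ P + (r² + a²)⁻⁵ P₁` wherever `r² + a² ≠ 0` (`P = critPoly`,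
`P₁ = critPoly₁`). [cite: DafermosRodnianskiShlapentokhrothman2014, §6.2] -/
theorem hasDerivAt_sepPotential (M a ω : ℝ) (m : ℤ) (Λ : ℝ) {r : ℝ} (hr : r ^ 2 + a ^ 2 ≠ 0) :
    HasDerivAt (sepPotential M a ω m Λ)
      (critPoly M a ω m Λ r / (r ^ 2 + a ^ 2) ^ 3 + critPoly₁ M a r / (r ^ 2 + a ^ 2) ^ 5) r :=
  (hasDerivAt_sepPotential₀_critPoly M a ω m Λ hr).add (hasDerivAt_sepPotential₁ M a hr)

/-- `deriv V = (r² + a²)⁻³ P + (r² + a²)⁻⁵ P₁` wherever `r² + a² ≠ 0`. [cite: DafermosRodnianskiShlapentokhrothman2014, §6.2] -/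
theorem deriv_sepPotential_eq (M a ω : ℝ) (m : ℤ) (Λ : ℝ) {r : ℝ} (hr : r ^ 2 + a ^ 2 ≠ 0) :
    deriv (sepPotential M a ω m Λ) r =
      critPoly M a ω m Λ r / (r ^ 2 + a ^ 2) ^ 3 + critPoly₁ M a r / (r ^ 2 + a ^ 2) ^ 5 :=
  (hasDerivAt_sepPotential M a ω m Λ hr).deriv

/-- **`|dV/dr| ≤ 24Λ/r³ + 184M/r⁴`** on `r ≥ r₊` for `0 < M`, `|a| ≤ M` and an admissible triple —
the bound (someBoundS) on `V' = (Δ/(r² + a²)) dV/dr` of DRSR arXiv:1402.7034, §8.4, in explicit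
form. [cite: DafermosRodnianskiShlapentokhrothman2014, §8.4] -/
theorem abs_deriv_sepPotential_le {M a ω Λ r : ℝ} {m : ℤ} (hM : 0 < M) (haM : |a| ≤ M)
    (hadm : IsAdmissibleTriple a ω m Λ) (hr : rPlus M a ≤ r) :
    |deriv (sepPotential M a ω m Λ) r| ≤ 24 * Λ / r ^ 3 + 184 * M / r ^ 4 := by
  have hMr : M ≤ r := (M_le_rPlus M a).trans hr
  have hr0 : 0 < r := hM.trans_le hMr
  have hD : 0 < r ^ 2 + a ^ 2 := by positivity
  rw [deriv_sepPotential_eq M a ω m Λ hD.ne', ← deriv_sepPotential₀_eq M a ω m Λ hD.ne',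
    ← deriv_sepPotential₁_eq M a hD.ne']
  exact (abs_add_le _ _).trans (add_le_add (abs_deriv_sepPotential₀_le hM haM hadm hMr)
    (abs_deriv_sepPotential₁_le hM haM hMr))

/-- `P ≤ 0` for `r ≥ 7M` and every admissible triple (`|a| < M`): `< 0` when `Λ > 0`
(`critPoly_neg_of_seven_mul_le`), and `P = 0` when `Λ = 0` (then `m = 0`). [cite: DafermosRodnianskiShlapentokhrothman2014, Lemma 6.3.1] -/
theorem critPoly_nonpos_of_seven_mul_le {M a ω Λ r : ℝ} {m : ℤ} (hMa : IsSubextremal M a)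
    (hadm : IsAdmissibleTriple a ω m Λ) (hr : 7 * M ≤ r) : critPoly M a ω m Λ r ≤ 0 := by
  rcases hadm.nonneg.eq_or_lt with hΛ | hΛ
  · -- `Λ = 0` forces `m = 0`, and then `P = 0`
    have hm : (m : ℝ) = 0 := by
      have h1 := hadm.1
      rw [← hΛ] at h1
      have h0 : 0 ≤ |(m : ℝ)| := abs_nonneg _
      have : |(m : ℝ)| = 0 := by nlinarith
      exact abs_eq_zero.1 this
    unfold critPoly
    rw [hm, ← hΛ]
    simp
  · exact (critPoly_neg_of_seven_mul_le hMa hadm hΛ hr).le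

/-- **(decrease) with the explicit radius `R_dec = 7M`**: for `|a| < M` and every admissible
frequency triple `(ω, m, Λ)`, `dV/dr < 0` for all `r ≥ 7M`; hence `V' = (Δ/(r² + a²)) dV/dr < 0`
for `r* ≥ (7M)*`. DRSR arXiv:1402.7034, §8.4, proof of Prop. 8.4.1 ("there exists a constant
`R*_dec ≥ 2R*₊` only depending on `a₀` and `M` such that `V' < 0` for `r* ≥ R*_dec`"; here the
radius does not even depend on `a₀`). [cite: DafermosRodnianskiShlapentokhrothman2014, Prop. 8.4.1 (proof)] -/
theorem deriv_sepPotential_neg_of_seven_mul_le {M a ω Λ r : ℝ} {m : ℤ} (hMa : IsSubextremal M a)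
    (hadm : IsAdmissibleTriple a ω m Λ) (hr : 7 * M ≤ r) :
    deriv (sepPotential M a ω m Λ) r < 0 := by
  have hM := hMa.pos
  have hr0 : 0 < r := by linarith
  have hD : 0 < r ^ 2 + a ^ 2 := by positivity
  rw [deriv_sepPotential_eq M a ω m Λ hD.ne']
  have h0 : critPoly M a ω m Λ r / (r ^ 2 + a ^ 2) ^ 3 ≤ 0 :=
    div_nonpos_of_nonpos_of_nonneg (critPoly_nonpos_of_seven_mul_le hMa hadm hr) (by positivity)
  have h1 : critPoly₁ M a r / (r ^ 2 + a ^ 2) ^ 5 < 0 :=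
    div_neg_of_neg_of_pos (critPoly₁_neg_of_five_mul_le hM (le_of_lt hMa) (by linarith)) (by positivity)
  linarith

/-- **(decrease), stated on the half-line**: for `|a| < M` and an admissible triple, `V` is
strictly decreasing on `[7M, ∞)`. DRSR arXiv:1402.7034, §8.4 (decrease). [cite: DafermosRodnianskiShlapentokhrothman2014, Prop. 8.4.1 (proof)] -/
theorem strictAntiOn_sepPotential_Ici {M a ω Λ : ℝ} {m : ℤ} (hMa : IsSubextremal M a)
    (hadm : IsAdmissibleTriple a ω m Λ) :
    StrictAntiOn (sepPotential M a ω m Λ) (Ici (7 * M)) := by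
  have hM := hMa.pos
  refine strictAntiOn_of_deriv_neg (convex_Ici _) ?_ fun r hr ↦ ?_
  · refine fun r hr ↦ (hasDerivAt_sepPotential M a ω m Λ ?_).continuousAt.continuousWithinAt
    have : 0 < r := by linarith [mem_Ici.1 hr]
    positivity
  · rw [interior_Ici] at hr
    exact deriv_sepPotential_neg_of_seven_mul_le hMa hadm (le_of_lt hr)

end Kerr

end Literature.Geometry.Lorentzian

end
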